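import Summits.CriticalPhenomena.PercolationContinuityZ3.Theorems.PercNearOneGluingNoHeavyLowerTailSahiCombHybridKernel

/-!
# The comb hierarchy for Sahi's `E_k`: the HYBRID-READING KERNEL, II — the minimal-multidegree (M⁺⁺) coefficients made EXPLICIT;
# (M⁺⁺-k) ⟺ microcanonical Sahi positivity

Support file of the one-cut programme (crux `NoHeavyLowerTail`, stmt-CriticalPhenomena-4575; cell `prim-masterthm`, seat P5 gen 5;
report `P5-LORENTZIAN-TEST.md` §10); companion of `…SahiCombHybridKernel` (hybrid configurations, hybrid replica lemma).

* `SahiHybrid.trunc`, `kernel_trunc` — the hybrid kernel reads the bit `(x, e)` only if `e ∈ E x`;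
* `SahiHybrid.redProfile E ξ` (`s_e = #{x : e ∈ E x, e ∈ ξ_x}`), `SahiHybrid.minDeg E` (`r_e = #{x : e ∈ E x}`), and the EXPLICIT
  coefficients **`SahiHybrid.hybCoeff E U s = Σ_{truncated copy arrays with reduced profile s} kernel`**;
* **`SahiHybrid.sahiE_eq_sum_hybCoeff`** — the tensor-Bernstein expansion at the MINIMAL multidegree with explicit coefficients:
  `E_k(μ_p; 1_U) = Σ_{s ≤ r} hybCoeff(s)·∏_e p_e^{s_e}(1−p_e)^{r_e−s_e}` for every family determined by the declared supports
  (`sum_fibre_weight_eq_bern`: the `μ_p^{⊗k}`-mass of a fibre of `trunc` is the reduced Bernstein monomial);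
* `combPos_of_hybCoeff_nonneg`, `combPos_of_kernel_nonneg` (pointwise `kernel ≥ 0` suffices — the cylinder mechanism of report §9.4,
  where the block system read by the kernel is the union-closed max-system of `…SahiUnionClosedMaxSystem`; pointwise nonnegativity
  FAILS in general already for `k = 2`, report §10.1), **`eq_hybCoeff_of_repr`** (THE coefficients: every representation at
  multidegree `minDeg E` has coefficients `hybCoeff`, by `SahiComb.bern_coeff_unique`);
* **`SahiHybrid.masterFamilyCombMinDegPos_iff`**: (M⁺⁺-k) ⟺ `hybCoeff (esupp ∘ U) U s ≥ 0` for all finite cubes, increasing `U` and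
  profiles `s` — "MICROCANONICAL Sahi positivity" (report §10.2: `hybCoeff(s)/∏_e C(r_e,s_e)` is Sahi's functional with the blocks of
  each partition sampling the coordinate-`e` bits WITHOUT replacement from an urn with `s_e` ones among `r_e`; for `k = 3`, `r ≡ 3`,
  `s ≡ 1` the colour classes of a uniform 3-colouring); `masterFamilyNonneg_of_hybCoeff_nonneg`.
Everything here is proved; axioms standard.  HONEST LABEL: identities and a reformulation; (M⁺⁺-k)/(M⁺-k)/`C_k` stay OPEN for
`k ≥ 3` (census: (M⁺⁺) 0 violations through (4,4) and (5,4) EXHAUSTIVE, ttrl cp-mpp 2026-08-20). [this work]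
-/

noncomputable section

open scoped Classical

namespace Summit.CriticalPhenomena.PercolationContinuityZ3.Theorems

open Finset Function
open Literature.Combinatorics.Sahi2008
open Literature.Probability.Percolation (DeterminedBy determinedBy_iff)
open Literature.Probability.Percolation.DecisionTree (ind ind_of_mem ind_of_not_mem ind_nonneg)
open SahiComb

namespace SahiHybrid

variable {ι : Type} {k : ℕ}

/-! ### Truncation to the declared supports and the reduced profile -/

section Reduced

variable (E : Fin k → Finset ι)

/-- Truncate each copy to the declared support of its member. [this work] -/
def trunc (ω : Fin k → Set ι) : Fin k → Set ι := fun x => ω x ∩ ↑(E x)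

/-- The hybrids only read bits `(x, e)` with `e ∈ E x`. [this work] -/
theorem hybrid_trunc (B : Finset (Fin k)) (ω : Fin k → Set ι) : hybrid E B (trunc E ω) = hybrid E B ω := by
  ext e
  by_cases h : (B ∩ slot E e).Nonempty
  · rw [mem_hybrid_iff h, mem_hybrid_iff h]
    simp only [trunc, Set.mem_inter_iff, mem_coe]
    exact ⟨fun h' => h'.1, fun h' => ⟨h', (max'_mem_inter h).2⟩⟩
  · exact ⟨fun h' => absurd h' (not_mem_hybrid h), fun h' => absurd h' (not_mem_hybrid h)⟩

/-- So does the kernel. [this work] -/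
theorem kernel_trunc (U : Fin k → Set (Set ι)) (ω : Fin k → Set ι) : kernel E U (trunc E ω) = kernel E U ω := by
  unfold kernel
  simp_rw [hybrid_trunc]

/-- The fibre of `trunc` over a truncated array. [this work] -/
theorem trunc_eq_iff {ξ : Fin k → Set ι} (hξ : ∀ x, ξ x ⊆ ↑(E x)) (ω : Fin k → Set ι) :
    trunc E ω = ξ ↔ ∀ x, ω x ∩ ↑(E x) = ξ x ∩ ↑(E x) := by
  have hx : ∀ x, ξ x ∩ ↑(E x) = ξ x := fun x => Set.inter_eq_left.2 (hξ x)
  simp only [funext_iff, trunc, hx]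

/-- The **reduced profile** of a copy array: at `e`, the number of interested members whose copy is open at `e`. [this work] -/
def redProfile (ξ : Fin k → Set ι) : ι → ℕ := fun e => ((slot E e).filter fun x => e ∈ ξ x).card

/-- The **minimal multidegree** of the declared supports: `r_e = #{i : e ∈ E i}`. [this work] -/
def minDeg : ι → ℕ := fun e => (slot E e).card

variable [Fintype ι]

/-- Reduced profiles lie in the box of the minimal multidegree. [this work] -/
theorem redProfile_mem_box (ξ : Fin k → Set ι) : redProfile E ξ ∈ box (minDeg E) :=
  mem_box.2 fun _ => card_filter_le _ _

/-- The truncated copy arrays (copy `x` supported on `E x`). [this work] -/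
def truncSpace : Finset (Fin k → Set ι) := univ.filter fun ξ => ∀ x, ξ x ⊆ ↑(E x)

/-- Membership in the truncated arrays. [this work] -/
theorem mem_truncSpace {ξ : Fin k → Set ι} : ξ ∈ truncSpace E ↔ ∀ x, ξ x ⊆ ↑(E x) := by
  simp [truncSpace]

/-- `trunc` lands in the truncated arrays. [this work] -/
theorem trunc_mem_truncSpace (ω : Fin k → Set ι) : trunc E ω ∈ truncSpace E :=
  (mem_truncSpace E).2 fun _ => Set.inter_subset_right

/-- **The explicit (M⁺⁺) coefficients**: the fibre sum of the hybrid kernel over the truncated copy arrays with reduced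
profile `s`. [this work] -/
def hybCoeff (U : Fin k → Set (Set ι)) (s : ι → ℕ) : ℝ :=
  ∑ ξ ∈ (truncSpace E).filter (fun ξ => redProfile E ξ = s), kernel E U ξ

/-- The `μ_p^{⊗k}`-mass of the fibre of `trunc` over a truncated array is the reduced Bernstein monomial of its profile. [this work] -/
theorem sum_fibre_weight_eq_bern (p : ι → unitInterval) {ξ : Fin k → Set ι} (hξ : ∀ x, ξ x ⊆ ↑(E x)) :
    ∑ ω ∈ univ.filter (fun ω => trunc E ω = ξ), ∏ x, bernoulliWeight p (ω x) = bern (minDeg E) (redProfile E ξ) p := by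
  calc ∑ ω ∈ univ.filter (fun ω => trunc E ω = ξ), ∏ x, bernoulliWeight p (ω x)
      = ∑ ω : Fin k → Set ι, ∏ x, (if ω x ∩ ↑(E x) = ξ x ∩ ↑(E x) then bernoulliWeight p (ω x) else 0) := by
        rw [sum_filter]
        refine sum_congr rfl fun ω _ => ?_
        rw [prod_ite_zero]
        by_cases h : trunc E ω = ξ
        · rw [if_pos h, if_pos fun x _ => (trunc_eq_iff E hξ ω).1 h x]
        · rw [if_neg h, if_neg fun h' => h ((trunc_eq_iff E hξ ω).2 fun x => h' x (mem_univ x))]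
    _ = ∏ x : Fin k, ∑ α : Set ι, (if α ∩ ↑(E x) = ξ x ∩ ↑(E x) then bernoulliWeight p α else 0) :=
        (Fintype.prod_sum (fun x α => if α ∩ ↑(E x) = ξ x ∩ ↑(E x) then bernoulliWeight p α else 0)).symm
    _ = ∏ x : Fin k, ∏ e ∈ E x, (if e ∈ ξ x then (p e : ℝ) else 1 - p e) :=
        prod_congr rfl fun x _ => SahiCombTensor.sum_bernoulliWeight_inter_eq p (E x) (ξ x)
    _ = ∏ e, ∏ x ∈ slot E e, (if e ∈ ξ x then (p e : ℝ) else 1 - p e) := by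
        exact Finset.prod_comm' fun _ _ => by simp only [mem_univ, true_and, and_true, mem_slot]
    _ = bern (minDeg E) (redProfile E ξ) p := by
        unfold bern minDeg redProfile
        refine prod_congr rfl fun e _ => ?_
        rw [prod_ite, prod_const, prod_const]
        congr 1
        rw [← Finset.card_filter_add_card_filter_not (s := slot E e) (fun x => e ∈ ξ x)]
        simp

/-- **The tensor-Bernstein expansion at the minimal multidegree, with EXPLICIT coefficients**:
`E_k(μ_p; 1_U) = Σ_{s ≤ r} hybCoeff(s)·∏_e p_e^{s_e}(1−p_e)^{r_e−s_e}` (`r = minDeg E`), for every family of events determined by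
the declared supports. [this work] -/
theorem sahiE_eq_sum_hybCoeff (p : ι → unitInterval) (U : Fin (k + 1) → Set (Set ι)) (E : Fin (k + 1) → Finset ι)
    (hU : ∀ i, DeterminedBy (U i) ↑(E i)) :
    sahiE (bernoulliWeight p) (k + 1) (fun i => ind (U i))
      = ∑ s ∈ box (minDeg E), hybCoeff E U s * bern (minDeg E) s p := by
  rw [sahiE_eq_sum_kernel p U E hU]
  -- group the copies by their truncation
  have h1 : ∑ ω : Fin (k + 1) → Set ι, (∏ x, bernoulliWeight p (ω x)) * kernel E U ω
      = ∑ ξ ∈ truncSpace E, kernel E U ξ * bern (minDeg E) (redProfile E ξ) p := by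
    rw [← sum_fiberwise_of_maps_to (s := (univ : Finset (Fin (k + 1) → Set ι))) (t := truncSpace E)
      (g := trunc E) (fun ω _ => trunc_mem_truncSpace E ω)]
    refine sum_congr rfl fun ξ hξ => ?_
    have hξ' : ∀ x, ξ x ⊆ ↑(E x) := (mem_truncSpace E).1 hξ
    rw [← sum_fibre_weight_eq_bern E p hξ', mul_sum]
    refine sum_congr rfl fun ω hω => ?_
    have hω' : trunc E ω = ξ := (mem_filter.1 hω).2
    rw [← kernel_trunc E U ω, hω', mul_comm]
  rw [h1]
  -- group the truncated arrays by their reduced profile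
  rw [← sum_fiberwise_of_maps_to (s := truncSpace E) (t := box (minDeg E)) (g := redProfile E)
    (fun ξ _ => redProfile_mem_box E ξ)]
  refine sum_congr rfl fun s _ => ?_
  unfold hybCoeff
  rw [sum_mul]
  refine sum_congr rfl fun ξ hξ => ?_
  rw [(mem_filter.1 hξ).2]

/-- Outside the box the coefficients vanish (no truncated array has such a profile). [this work] -/
theorem hybCoeff_eq_zero_of_not_mem_box (U : Fin k → Set (Set ι)) {s : ι → ℕ} (hs : s ∉ box (minDeg E)) :
    hybCoeff E U s = 0 := by
  unfold hybCoeff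
  refine sum_eq_zero fun ξ hξ => ?_
  exact absurd ((mem_filter.1 hξ).2 ▸ redProfile_mem_box E ξ) hs

/-- **(M⁺⁺) from nonnegative fibre sums**: if every `hybCoeff` is `≥ 0` the family is comb-positive at the minimal multidegree. [this work] -/
theorem combPos_of_hybCoeff_nonneg (U : Fin (k + 1) → Set (Set ι)) (E : Fin (k + 1) → Finset ι)
    (hU : ∀ i, DeterminedBy (U i) ↑(E i)) (h : ∀ s, 0 ≤ hybCoeff E U s) :
    CombPos (minDeg E) (fun p => sahiE (bernoulliWeight p) (k + 1) (fun i => ind (U i))) :=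
  ⟨hybCoeff E U, h, fun p => sahiE_eq_sum_hybCoeff p U E hU⟩

/-- Pointwise nonnegativity of the kernel gives nonnegative fibre sums. [this work] -/
theorem hybCoeff_nonneg_of_kernel_nonneg (U : Fin k → Set (Set ι)) (h : ∀ ω, 0 ≤ kernel E U ω) (s : ι → ℕ) :
    0 ≤ hybCoeff E U s :=
  sum_nonneg fun ξ _ => h ξ

/-- **(M⁺⁺) from a pointwise nonnegative kernel** (the cylinder mechanism of report §9.4; fails in general, report §10.1). [this work] -/
theorem combPos_of_kernel_nonneg (U : Fin (k + 1) → Set (Set ι)) (E : Fin (k + 1) → Finset ι)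
    (hU : ∀ i, DeterminedBy (U i) ↑(E i)) (h : ∀ ω, 0 ≤ kernel E U ω) :
    CombPos (minDeg E) (fun p => sahiE (bernoulliWeight p) (k + 1) (fun i => ind (U i))) :=
  combPos_of_hybCoeff_nonneg U E hU (hybCoeff_nonneg_of_kernel_nonneg E U h)

/-- **THE coefficients**: any tensor-Bernstein representation of `p ↦ E_k(μ_p; 1_U)` at the multidegree `minDeg E` has the fibre
sums `hybCoeff` as its coefficients (uniqueness of tensor-Bernstein coefficients, `SahiComb.bern_coeff_unique`). [this work] -/
theorem eq_hybCoeff_of_repr (U : Fin (k + 1) → Set (Set ι)) (E : Fin (k + 1) → Finset ι)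
    (hU : ∀ i, DeterminedBy (U i) ↑(E i)) {N : (ι → ℕ) → ℝ}
    (hN : ∀ p, sahiE (bernoulliWeight p) (k + 1) (fun i => ind (U i)) = ∑ j ∈ box (minDeg E), N j * bern (minDeg E) j p) :
    ∀ s ∈ box (minDeg E), N s = hybCoeff E U s :=
  bern_coeff_unique fun p => (hN p).symm.trans (sahiE_eq_sum_hybCoeff p U E hU)

end Reduced

/-! ### (M⁺⁺-k) ⟺ nonnegativity of the explicit coefficients -/

section Master

variable [Fintype ι]

/-- The minimal multidegree of the essential supports is the multidegree of (M⁺⁺-k). [this work] -/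
theorem minDeg_esupp (U : Fin k → Set (Set ι)) :
    minDeg (fun i => esupp (U i)) = fun e => ∑ i, if e ∈ esupp (U i) then 1 else 0 := by
  funext e
  unfold minDeg slot
  rw [card_filter]

/-- **(M⁺⁺-k) ⟺ MICROCANONICAL SAHI POSITIVITY**: the minimal-multidegree comb positivity of every family of `k` increasing events
holds iff, for every finite cube, every increasing family and every reduced profile `s`, the fibre sum `hybCoeff (esupp ∘ U) U s`
of the hybrid kernel is nonnegative. [this work] -/
theorem masterFamilyCombMinDegPos_iff (k : ℕ) :
    MasterFamilyCombMinDegPos (k + 1) ↔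
      ∀ (ι : Type) [Fintype ι] (U : Fin (k + 1) → Set (Set ι)), (∀ i, IsUpperSet (U i)) →
        ∀ s, 0 ≤ hybCoeff (fun i => esupp (U i)) U s := by
  constructor
  · intro h ι _ U hU s
    obtain ⟨N, hN, hrep⟩ := h ι U hU
    rw [← minDeg_esupp U] at hrep
    by_cases hs : s ∈ box (minDeg fun i => esupp (U i))
    · rw [← eq_hybCoeff_of_repr U (fun i => esupp (U i)) (fun i => determinedBy_esupp (hU i)) hrep s hs]
      exact hN s
    · rw [hybCoeff_eq_zero_of_not_mem_box _ U hs]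
  · intro h ι _ U hU
    rw [← minDeg_esupp U]
    exact combPos_of_hybCoeff_nonneg U (fun i => esupp (U i)) (fun i => determinedBy_esupp (hU i)) (h ι U hU)

/-- Hence microcanonical positivity at every order gives Sahi's `C_k` for every product measure. [this work] -/
theorem masterFamilyNonneg_of_hybCoeff_nonneg (k : ℕ)
    (h : ∀ (ι : Type) [Fintype ι] (U : Fin (k + 1) → Set (Set ι)), (∀ i, IsUpperSet (U i)) →
        ∀ s, 0 ≤ hybCoeff (fun i => esupp (U i)) U s) :
    MasterFamilyNonneg (k + 1) :=
  masterFamilyNonneg_of_minDegPos ((masterFamilyCombMinDegPos_iff k).2 h)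

end Master

end SahiHybrid

end Summit.CriticalPhenomena.PercolationContinuityZ3.Theorems
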